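import Literature.Geometry.Lorentzian.KerrIngoingCoordConnection
import Literature.Geometry.Lorentzian.CoordCurvatureNormSq
import HarnessLib

/-!
# The rational principal frame of Kerr (ingoing Kerr coordinates): basis, Gram matrix, inverse

Infrastructure (all results proved, no definitions) for the curvature invariants of the Kerr metric
(Kretschmann scalar and cubic Weyl invariant, `KerrCurvatureInvariantsIngoing.lean`; fact stubs F3/F4
of crux `TameCensorship`, `KerrKretschmannScalar.lean`).
In ingoing Kerr coordinates `u = (t*, r, μ, φ)` (`KerrIngoingCoordMetric.lean`) the Kerr metric has the
rational PRINCIPAL FRAME `l = (r² + 2Mr + a²)∂_{t*} + Δ∂_r + 2a∂_φ`, `n = ∂_{t*} − ∂_r`,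
`e₃ = (1 − μ²)∂_μ`, `e₄ = a(1 − μ²)∂_{t*} + ∂_φ` (Gram matrix `g(l,n) = −2Σ`,
`g(e₃,e₃) = g(e₄,e₄) = Σ(1 − μ²)`, else `0`), in which the curvature has the Petrov type D pattern
generated by `Ψ₂ = −M/(r − iaμ)³` alone (Kerr 1963; Kinnersley 1969). The frame vectors are written
out explicitly (no definitions are introduced); everything is proved.

* `MetricCoord.basis_action_comp`, `MetricCoord.traceCLM_eq_sum_of_basis_action`,
  `…_comp_eq_sum_of_basis_action`, `…_comp₃_eq_sum_of_basis_action` — traces of (compositions of)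
  endomorphisms from their action matrices on a basis (generic linear algebra);
* `Kerr.Ingoing.exists_frameBasis` — the frame is a `Module.Basis (Fin 4) ℝ E4` on the regular set;
  `Kerr.Ingoing.bilin_frame` (Gram matrix), `Kerr.Ingoing.eq_of_bilin_frame` (vectors are determined
  by their pairings with the frame), `Kerr.Ingoing.ginv_frame` (`g^{ln} = −1/(2Σ)`,
  `g^{33} = g^{44} = 1/(Σ(1−μ²))`), `Kerr.Ingoing.pf_sum_ginv` (a contraction collapses to one term).

## References

* R. P. Kerr, Phys. Rev. Lett. 11 (1963) 237–238; R. P. Kerr, A. Schild, *A new class of vacuum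
  solutions of the Einstein field equations* (1965), §3. [KerrSchild1965]
* W. Kinnersley, *Type D vacuum metrics*, J. Math. Phys. 10 (1969) 1195.
* M. Visser, *The Kerr spacetime: a brief introduction*, arXiv:0706.0622, §3. [arXiv07060622]
* B. O'Neill, *Semi-Riemannian geometry* (1983), Ch. 3, Lemma 3.38, Prop. 3.36, pp. 60–61. [ONeill1983]
-/

noncomputable section

set_option maxSynthPendingDepth 3

open Set Function Module
open scoped ContDiff Topology
open Literature.Geometry.Lorentzian.MetricCoord

namespace Literature.Geometry.Lorentzian

/-! ### Traces from the action of endomorphisms on a basis -/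

namespace MetricCoord

variable {E : Type*} [NormedAddCommGroup E] [NormedSpace ℝ E] [FiniteDimensional ℝ E]
  {ι : Type*} [Fintype ι] (b : Basis ι ℝ E)

omit [FiniteDimensional ℝ E] in
/-- If `E₁ b_q = Σ_p N₁[p,q] b_p` and `E₂ b_q = Σ_p N₂[p,q] b_p`, then `E₁ ∘ E₂` acts by the matrix
product `N₁ N₂`. [folklore] -/
theorem basis_action_comp {E₁ E₂ : E →L[ℝ] E} {N₁ N₂ : ι → ι → ℝ}
    (h₁ : ∀ q, E₁ (b q) = ∑ p, N₁ p q • b p) (h₂ : ∀ q, E₂ (b q) = ∑ p, N₂ p q • b p) (q : ι) :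
    (E₁.comp E₂) (b q) = ∑ p, (∑ s, N₁ p s * N₂ s q) • b p := by
  rw [ContinuousLinearMap.comp_apply, h₂, map_sum]
  simp_rw [map_smul, h₁, Finset.smul_sum, smul_smul]
  rw [Finset.sum_comm]
  refine Finset.sum_congr rfl fun p _ ↦ ?_
  rw [Finset.sum_smul]
  refine Finset.sum_congr rfl fun s _ ↦ ?_
  rw [mul_comm]

/-- **The trace from the action on a basis**: if `E₁ b_q = Σ_p N₁[p,q] b_p` then `tr E₁ = Σ_p N₁[p,p]`.
[folklore] -/
theorem traceCLM_eq_sum_of_basis_action {E₁ : E →L[ℝ] E} {N₁ : ι → ι → ℝ}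
    (h₁ : ∀ q, E₁ (b q) = ∑ p, N₁ p q • b p) : traceCLM E E₁ = ∑ p, N₁ p p := by
  rw [traceCLM_apply, trace_eq_sum_coord b]
  refine Finset.sum_congr rfl fun p _ ↦ ?_
  rw [ContinuousLinearMap.coe_coe, h₁, Basis.coord_apply, b.repr_sum_self]

/-- Trace of a composition of two endomorphisms from their actions on a basis. [folklore] -/
theorem traceCLM_comp_eq_sum_of_basis_action {E₁ E₂ : E →L[ℝ] E} {N₁ N₂ : ι → ι → ℝ}
    (h₁ : ∀ q, E₁ (b q) = ∑ p, N₁ p q • b p) (h₂ : ∀ q, E₂ (b q) = ∑ p, N₂ p q • b p) :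
    traceCLM E (E₁.comp E₂) = ∑ p, ∑ s, N₁ p s * N₂ s p :=
  traceCLM_eq_sum_of_basis_action b (basis_action_comp b h₁ h₂)

/-- Trace of a composition of three endomorphisms from their actions on a basis. [folklore] -/
theorem traceCLM_comp₃_eq_sum_of_basis_action {E₁ E₂ E₃ : E →L[ℝ] E} {N₁ N₂ N₃ : ι → ι → ℝ}
    (h₁ : ∀ q, E₁ (b q) = ∑ p, N₁ p q • b p) (h₂ : ∀ q, E₂ (b q) = ∑ p, N₂ p q • b p)
    (h₃ : ∀ q, E₃ (b q) = ∑ p, N₃ p q • b p) :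
    traceCLM E (E₁.comp (E₂.comp E₃)) = ∑ p, ∑ s, N₁ p s * ∑ t, N₂ s t * N₃ t p :=
  traceCLM_eq_sum_of_basis_action b (basis_action_comp b h₁ (basis_action_comp b h₂ h₃))

end MetricCoord


namespace Kerr

namespace Ingoing

variable (M a : ℝ) {u : E4}

/-! ### The rational principal frame of Kerr as a basis; its Gram matrix and inverse -/




/-- Components of linear combinations in `E4`. [folklore] -/
theorem sum_smul_apply (g : Fin 4 → ℝ) (v : Fin 4 → E4) (k : Fin 4) :
    (∑ i, g i • v i) k = ∑ i, g i * v i k := by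
  rw [WithLp.ofLp_sum, Finset.sum_apply]
  simp [smul_eq_mul]

/-- **The rational principal frame is a basis of `E4`** on the regular set (`det = −2Σ(1 − μ²)`):
there is a `Module.Basis (Fin 4) ℝ E4` consisting of `l, n, e₃, e₄`. [cite: KerrSchild1965, §3] -/
theorem exists_frameBasis (hu : u ∈ regularSet a) :
    ∃ 𝔣 : Module.Basis (Fin 4) ℝ E4, ∀ i, 𝔣 i =
      ![(!₂[u 1 ^ 2 + 2 * M * u 1 + a ^ 2, u 1 ^ 2 - 2 * M * u 1 + a ^ 2, (0 : ℝ), 2 * a] : E4),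
        (!₂[(1 : ℝ), -1, 0, 0] : E4), (!₂[(0 : ℝ), 0, 1 - u 2 ^ 2, 0] : E4),
        (!₂[a * (1 - u 2 ^ 2), (0 : ℝ), 0, 1] : E4)] i := by
  have hS := hu.1
  have hP := hu.2
  set v : Fin 4 → E4 := ![(!₂[u 1 ^ 2 + 2 * M * u 1 + a ^ 2, u 1 ^ 2 - 2 * M * u 1 + a ^ 2, (0 : ℝ), 2 * a] : E4),
        (!₂[(1 : ℝ), -1, 0, 0] : E4), (!₂[(0 : ℝ), 0, 1 - u 2 ^ 2, 0] : E4),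
        (!₂[a * (1 - u 2 ^ 2), (0 : ℝ), 0, 1] : E4)] with hv
  have hli : LinearIndependent ℝ v := by
    rw [Fintype.linearIndependent_iff]
    intro g hg
    have hk : ∀ k, ∑ i, g i * v i k = 0 := fun k ↦ by rw [← sum_smul_apply, hg]; simp
    have h0 := hk 0
    have h1 := hk 1
    have h2 := hk 2
    have h3 := hk 3
    simp only [hv, Fin.sum_univ_four, Fin.isValue, Matrix.cons_val_zero,
      Matrix.cons_val_one, Matrix.cons_val, PiLp.toLp_apply, mul_zero, mul_one,
      add_zero, zero_add, mul_neg] at h0 h1 h2 h3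
    have hg2 : g 2 = 0 := by
      rcases mul_eq_zero.1 h2 with h | h
      · exact h
      · exact absurd h (by simpa [sinSq] using hP)
    have hg0 : g 0 = 0 := by
      have key : g 0 * (2 * sigma a u) = 0 := by
        simp only [sigma]
        linear_combination h0 + h1 - (a * (1 - u 2 ^ 2)) * h3
      rcases mul_eq_zero.1 key with h | h
      · exact h
      · exact absurd h (mul_ne_zero two_ne_zero hS)
    have hg1 : g 1 = 0 := by rw [hg0] at h1; linarith
    have hg3 : g 3 = 0 := by rw [hg0] at h3; linarith
    intro i
    fin_cases i <;> assumption
  refine ⟨basisOfLinearIndependentOfCardEqFinrank hli (by simp), fun i ↦ ?_⟩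
  rw [coe_basisOfLinearIndependentOfCardEqFinrank]

/-- **The Gram matrix of the rational principal frame**: `g(l,n) = −2Σ`, `g(e₃,e₃) = g(e₄,e₄) = Σ(1−μ²)`,
all other pairings vanish (`l`, `n` null, `e₃, e₄ ⊥ l, n`). [cite: KerrSchild1965, §3] -/
theorem bilin_frame (hu : u ∈ regularSet a) (i j : Fin 4) :
    bilin M a u
      (![(!₂[u 1 ^ 2 + 2 * M * u 1 + a ^ 2, u 1 ^ 2 - 2 * M * u 1 + a ^ 2, (0 : ℝ), 2 * a] : E4),
        (!₂[(1 : ℝ), -1, 0, 0] : E4), (!₂[(0 : ℝ), 0, 1 - u 2 ^ 2, 0] : E4),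
        (!₂[a * (1 - u 2 ^ 2), (0 : ℝ), 0, 1] : E4)] i)
      (![(!₂[u 1 ^ 2 + 2 * M * u 1 + a ^ 2, u 1 ^ 2 - 2 * M * u 1 + a ^ 2, (0 : ℝ), 2 * a] : E4),
        (!₂[(1 : ℝ), -1, 0, 0] : E4), (!₂[(0 : ℝ), 0, 1 - u 2 ^ 2, 0] : E4),
        (!₂[a * (1 - u 2 ^ 2), (0 : ℝ), 0, 1] : E4)] j) =
      !![0, -(2 * sigma a u), 0, 0; -(2 * sigma a u), 0, 0, 0;
        0, 0, sigma a u * sinSq u, 0; 0, 0, 0, sigma a u * sinSq u] i j := by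
  have hS := hu.1
  have hP := hu.2
  fin_cases i <;> fin_cases j <;>
  · simp only [bilin_apply, Fin.isValue, Fin.zero_eta, Fin.mk_one, Fin.reduceFinMk, Matrix.cons_val_zero,
      Matrix.cons_val_one, Matrix.cons_val, Matrix.of_apply, Matrix.cons_val',
      Matrix.empty_val', Matrix.cons_val_fin_one, h00, h03, c13, c22, c33, scalarH]
    field_simp
    simp only [sigma, sinSq]
    ring


/-- **Vectors are determined by their pairings with the frame** (nondegeneracy of the Kerr
components on the regular set + the frame is a basis). [folklore] -/
theorem eq_of_bilin_frame (hu : u ∈ regularSet a) (𝔣 : Module.Basis (Fin 4) ℝ E4)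
    (h𝔣 : ∀ i, 𝔣 i =
      ![(!₂[u 1 ^ 2 + 2 * M * u 1 + a ^ 2, u 1 ^ 2 - 2 * M * u 1 + a ^ 2, (0 : ℝ), 2 * a] : E4),
        (!₂[(1 : ℝ), -1, 0, 0] : E4), (!₂[(0 : ℝ), 0, 1 - u 2 ^ 2, 0] : E4),
        (!₂[a * (1 - u 2 ^ 2), (0 : ℝ), 0, 1] : E4)] i)
    {v w : E4} (h : ∀ k, bilin M a u v (𝔣 k) = bilin M a u w (𝔣 k)) : v = w := by
  have _ := h𝔣
  obtain ⟨e, he⟩ := isInvertible_bilin M a hu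
  have hvw : bilin M a u (v - w) = 0 := by
    ext z
    rw [← 𝔣.sum_repr z, map_sum, _root_.zero_apply]
    refine Finset.sum_eq_zero fun k _ ↦ ?_
    rw [map_smul, smul_eq_mul, map_sub, _root_.sub_apply, h k, sub_self, mul_zero]
  have : e (v - w) = 0 := by rw [show e (v - w) = bilin M a u (v - w) from by rw [← he]; rfl, hvw]
  have h0 : v - w = 0 := by simpa using congrArg e.symm this
  exact sub_eq_zero.1 h0

/-- **The inverse metric coefficients of the Kerr components in the rational principal frame**:
`g^{ln} = g^{nl} = −1/(2Σ)`, `g^{33} = g^{44} = 1/(Σ(1−μ²))`, all others `0` (inverse of the Gram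
matrix `bilin_frame`). [cite: KerrSchild1965, §3] -/
theorem ginv_frame (hu : u ∈ regularSet a) (𝔣 : Module.Basis (Fin 4) ℝ E4)
    (h𝔣 : ∀ i, 𝔣 i =
      ![(!₂[u 1 ^ 2 + 2 * M * u 1 + a ^ 2, u 1 ^ 2 - 2 * M * u 1 + a ^ 2, (0 : ℝ), 2 * a] : E4),
        (!₂[(1 : ℝ), -1, 0, 0] : E4), (!₂[(0 : ℝ), 0, 1 - u 2 ^ 2, 0] : E4),
        (!₂[a * (1 - u 2 ^ 2), (0 : ℝ), 0, 1] : E4)] i) (i j : Fin 4) :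
    ginv (bilin M a) 𝔣 u i j =
      !![0, -(2 * sigma a u)⁻¹, 0, 0; -(2 * sigma a u)⁻¹, 0, 0, 0;
        0, 0, (sigma a u * sinSq u)⁻¹, 0; 0, 0, 0, (sigma a u * sinSq u)⁻¹] i j := by
  have hS := hu.1
  have hP := hu.2
  set A : Matrix (Fin 4) (Fin 4) ℝ := Matrix.of fun i j ↦ ginv (bilin M a) 𝔣 u i j with hA
  set Gm : Matrix (Fin 4) (Fin 4) ℝ := Matrix.of fun i j ↦ bilin M a u (𝔣 i) (𝔣 j) with hGm
  have h1 : A * Gm = 1 := by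
    ext i k
    rw [Matrix.mul_apply, Matrix.one_apply,
      ← sum_ginv_mul_apply_basis 𝔣 (isInvertible_bilin M a hu) i k]
    refine Finset.sum_congr rfl fun j _ ↦ ?_
    rw [hA, hGm, Matrix.of_apply, Matrix.of_apply, bilin_symm]
  set C : Matrix (Fin 4) (Fin 4) ℝ := !![0, -(2 * sigma a u)⁻¹, 0, 0; -(2 * sigma a u)⁻¹, 0, 0, 0;
        0, 0, (sigma a u * sinSq u)⁻¹, 0; 0, 0, 0, (sigma a u * sinSq u)⁻¹] with hC
  have hGm' : Gm = !![0, -(2 * sigma a u), 0, 0; -(2 * sigma a u), 0, 0, 0;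
        0, 0, sigma a u * sinSq u, 0; 0, 0, 0, sigma a u * sinSq u] := by
    ext i j
    rw [hGm, Matrix.of_apply, h𝔣 i, h𝔣 j, bilin_frame M a hu i j]
  have h2 : C * Gm = 1 := by
    rw [hGm', hC]
    ext k l
    fin_cases k <;> fin_cases l <;>
      simp [Matrix.mul_apply, Fin.sum_univ_four] <;> field_simp
  have h3 : Gm⁻¹ = A := Matrix.inv_eq_left_inv h1
  have h4 : Gm⁻¹ = C := Matrix.inv_eq_left_inv h2
  have h5 := congrFun (congrFun (h3.symm.trans h4) i) j
  rw [hA, Matrix.of_apply] at h5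
  rw [h5]

/-- **Sparsity of the inverse metric in the principal frame**: a contraction `Σ_i' g^{ii'} F(i')`
collapses to the single partner `σ(i)` (`l ↔ n`, `e₃, e₄` fixed) with weight `−1/(2Σ)` resp.
`1/(Σ(1−μ²))`. [cite: KerrSchild1965, §3] -/
theorem pf_sum_ginv (hu : u ∈ regularSet a) (𝔣 : Module.Basis (Fin 4) ℝ E4)
    (h𝔣 : ∀ i, 𝔣 i =
      ![(!₂[u 1 ^ 2 + 2 * M * u 1 + a ^ 2, u 1 ^ 2 - 2 * M * u 1 + a ^ 2, (0 : ℝ), 2 * a] : E4),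
        (!₂[(1 : ℝ), -1, 0, 0] : E4), (!₂[(0 : ℝ), 0, 1 - u 2 ^ 2, 0] : E4),
        (!₂[a * (1 - u 2 ^ 2), (0 : ℝ), 0, 1] : E4)] i) (F : Fin 4 → ℝ) (i : Fin 4) :
    ∑ i', ginv (bilin M a) 𝔣 u i i' * F i' =
      ![-(2 * sigma a u)⁻¹ * F 1, -(2 * sigma a u)⁻¹ * F 0, (sigma a u * sinSq u)⁻¹ * F 2,
        (sigma a u * sinSq u)⁻¹ * F 3] i := by
  fin_cases i <;> simp only [ginv_frame M a hu 𝔣 h𝔣, Fin.sum_univ_four, Fin.isValue, Fin.zero_eta, Fin.mk_one,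
    Fin.reduceFinMk, Matrix.of_apply, Matrix.cons_val', Matrix.cons_val_zero, Matrix.cons_val_one, Matrix.cons_val, Matrix.empty_val', Matrix.cons_val_fin_one, zero_mul, add_zero, zero_add]

end Ingoing

end Kerr

end Literature.Geometry.Lorentzian

end
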